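import Summits.HodgeConjecture.HodgeConjecture.Theorems.R90S4HLdsTwoOfReducibleSplit   -- ★ p861915 (this seat): brings ★ K2E3 `not_bot_lt_lt_lt_top_cmPrincipalSeries_two` ∕ `finrank_restrict_eq_one_of_ne_bot_of_ne_top_two`, ★ `ConstituentsOfExtension`, ★ `stub_R90_S4_H_lds_of_two_of_orbit`
import Summits.HodgeConjecture.HodgeConjecture.Theorems.R90S4U2OuterSimilSwap          -- ★ (R90-C131-p03): `hOrbit_of_hTwo_of_swap` ((ORBIT) ⟸ (TWO)+(SWAP))
import Summits.HodgeConjecture.HodgeConjecture.Theorems.F0P2pJacquetConstituentLemmas   -- ★ Frobenius reciprocity, uniqueness form: `intertwiningMap_normalizedInd_eq_smul`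
import Literature.NumberTheory.Automorphic.CMPrincipalSeriesJacquetEvalOne               -- ★ `continuous_torusCharPair_apply`
import Literature.RepresentationTheory.Semisimple.SubrepresentationEquiv                 -- ★ `Subrepresentation.isCompl_iff`, `subtypeIntertwiningMap_injective`
import Literature.RepresentationTheory.FiniteGroups.EquivOfCharacter                     -- ★ `Subrepresentation.subtypeIntertwiningMap`, `subtypeIntertwiningMap_ne_zero`
import HarnessLib

/-!
# R90-TF · S4 «Ch. 13.1–2» — socket S4#B5 `stub_R90_S4_H_lds`: (TWO) FROM DECOMPOSABILITY — if `i_G(χ) = N ⊕ N′` non-trivially then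
# `JH(i_G(χ)) = {⟦N⟧, ⟦N′⟧}` with `⟦N⟧ ≠ ⟦N′⟧` (Frobenius reciprocity + `dim r_B N = 1`); S4#B5 ⟸ (DECOMP) + (SWAP)

Cell `hodgecm-mathlib`, crux H413 (`stmt-HodgeConjecture-24833`, lane `--supports … --as helper`), route of record `HCCMUnconditional`
(no route verbs; count-neutral).  Programme R90-TF (HUMAN RULING «R90-TF SLAB — MAX PUSH»; brief `director/R90-BRIEF.v2.md`
1f40d54518340a35), section S4 = Rogawski Ch. 13.1–2 (base `R90-C131`); seat R90-C131-p05 (g0), socket S4#B5 dealt BY NAME; ruling (B5-p05) «=»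
(S4 dealer K2E2-plan (g6), 2026-09-04T16:25:44Z).  THEOREMS ONLY (no `def`, no instance, no notation, no named fact, no `sorry`); imports ★ only.

THE POINT.  ★ p861915 cut (TWO) «`JH(i_G(χ))` has exactly two elements» to (RED)+(DIST), (DIST) being «`i_G(χ)|_N ≇ i_G(χ) ⁄ N`».  Print states
case 2) as «`χ` is unitary and `JH(i_G(χ))` is an l.d.s. L-packet» — for unitary `χ` the principal series is unitarisable, so a reducible `i_G(χ)`
DECOMPOSES, `i_G(χ) = N ⊕ N′`.  This file shows that DECOMPOSABILITY ALONE already gives (TWO), i.e. the two summands are automatically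
INEQUIVALENT — no intertwining-operator input is needed for distinctness:

  `dim Hom_G(N, i_G(χ)) ≤ dim Hom_T(r_B N, ℂ_χ) ≤ dim r_B N = 1`

(Frobenius reciprocity, uniqueness form ★ `F0P2pJacquetConstituentLemmas.intertwiningMap_normalizedInd_eq_smul`; `dim r_B N = 1` for a proper
non-zero `N` is ★ `K2E3U2PrincipalSeriesNoThreeChain.finrank_restrict_eq_one_of_ne_bot_of_ne_top_two`, Casselman Prop. 7.1.3 on `U(1,1)`), whereas
`N ≅ N′` would give TWO independent `G`-maps `N ↪ i_G(χ)` (the inclusion, and `N ≅ N′ ↪ i_G(χ)` with image `N′`, `N ∩ N′ = 0`).  With ★ no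
3-chains (Casselman Cor. 7.1.2) `N`, `N′` are irreducible and `JH(i_G(χ)) = {⟦i_G(χ) ⁄ N⟧, ⟦N⟧} ∋ ⟦N′⟧`, whence `JH = {⟦N⟧, ⟦N′⟧}`, two DISTINCT classes.
* `two_of_isCompl` — (TWO) at `(L, v, χ)` (non-split `v`, `χ` continuous) from a non-trivial decomposition `IsCompl N N′`, `⊥ ≠ N ≠ ⊤`;
* `stub_R90_S4_H_lds_of_decomp_of_swap` — S4#B5's statement (B's defs unfolded) from (DECOMP) «`i_G((χ₁, χ₂))` has complementary proper non-zero
  subrepresentations» and p03's (SWAP), under the socket's guards (`χ₁, χ₂` with open kernels are continuous, so `(χ₁, χ₂)` is).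
NET RESIDUE of S4#B5 after this file: (DECOMP) [§11.1 p. 161 case 2): reducibility (Keys–Shahidi) + unitarity of `i_G(χ)`] and (SWAP) [Labesse–Langlands].

HONEST LABEL: HC_CM is proved only modulo the 7 printed citations (2 remaining named inputs: hLiu418 = stmt-HodgeConjecture-24832,
h413 = stmt-HodgeConjecture-24833) until rung 0 closes; this file CLOSES NOTHING by itself — (DECOMP) and (SWAP) are NOT in the tree.  REL ≠ ★ ≠ BUILT.

## References
* [Rogawski1990] J. D. Rogawski, *Automorphic Representations of Unitary Groups in Three Variables*, Ann. of Math. Stud. 123 (1990), §11.1 p. 161, §12.1 pp. 171–172.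
* [Casselman1995] W. Casselman, *Introduction to the theory of admissible representations of 𝔭-adic reductive groups* (1995), Thm. 3.2.4 (Frobenius reciprocity),
  Cor. 7.1.2, Prop. 7.1.3 p. 67.
* [BernsteinZelevinsky1977] I. N. Bernstein, A. V. Zelevinsky, *Induced representations of reductive 𝔭-adic groups I*, Ann. Sci. ÉNS 10 (1977), Prop. 1.9 (b), Thm. 2.8.
* [LabesseLanglands1979] J.-P. Labesse, R. P. Langlands, *L-indistinguishability for SL(2)*, Canad. J. Math. 31 (1979), 726–785.
-/

set_option autoImplicit false
-- the mandated namespace (brief §3.4) repeats the single-problem summit's segment (`HodgeConjecture.HodgeConjecture`)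
set_option linter.dupNamespace false

noncomputable section

open NumberField IsDedekindDomain Module
open scoped MatrixGroups
open Literature.NumberTheory.Automorphic Literature.NumberTheory.Automorphic.UnitaryGroup
open Literature.RepresentationTheory.FiniteGroups Literature.RepresentationTheory.Semisimple

namespace Summit.HodgeConjecture.HodgeConjecture.R90.S4

/-! ## §1 Generic plumbing -/

/-- **`ℂ`-valued `M`-maps out of a ONE-dimensional representation are proportional**: if `dim X = 1` and `ψ₁ ≠ 0` then `ψ₂ = c • ψ₁`
(`X = ℂ v₀`, `c = ψ₂(v₀) ψ₁(v₀)⁻¹`) — the input `huniq` of ★ `intertwiningMap_normalizedInd_eq_smul`. [folklore] [cite: Casselman1995, Thm. 3.2.4] -/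
theorem intertwiningMap_eq_smul_of_finrank_eq_one {M : Type*} [Group M] {X : Type*} [AddCommGroup X] [Module ℂ X]
    {π : Representation ℂ M X} {τ : Representation ℂ M ℂ} (hX : Module.finrank ℂ X = 1)
    (ψ₁ ψ₂ : π.IntertwiningMap τ) (h₁ : ψ₁ ≠ 0) : ∃ c : ℂ, ψ₂ = c • ψ₁ := by
  obtain ⟨v₀, -, hspan⟩ := finrank_eq_one_iff'.1 hX
  have h10 : ψ₁ v₀ ≠ 0 := by
    intro h0
    apply h₁
    refine Representation.IntertwiningMap.ext (LinearMap.ext fun w => ?_)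
    obtain ⟨a, rfl⟩ := hspan w
    rw [map_smul, Representation.IntertwiningMap.coe_toLinearMap, h0, smul_zero]
    rfl
  refine ⟨ψ₂ v₀ * (ψ₁ v₀)⁻¹, Representation.IntertwiningMap.ext (LinearMap.ext fun w => ?_)⟩
  obtain ⟨a, rfl⟩ := hspan w
  rw [map_smul, map_smul, Representation.IntertwiningMap.coe_toLinearMap, Representation.IntertwiningMap.toLinearMap_smul,
    LinearMap.smul_apply, Representation.IntertwiningMap.coe_toLinearMap, smul_eq_mul, smul_eq_mul, smul_eq_mul]
  field_simp

/-- A `ℂˣ`-valued character with OPEN KERNEL on a topological group is continuous into `ℂ` (constant on the cosets of its kernel) — so the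
socket's «smooth `χ₁, χ₂`» gives the continuity the Jacquet-module inputs ask for. [folklore] [cite: BernsteinZelevinsky1976, §2.1] -/
theorem continuous_unitsCoe_of_isOpen_ker {G : Type*} [Group G] [TopologicalSpace G] [ContinuousMul G] (ψ : G →* ℂˣ)
    (h : IsOpen ((ψ.ker : Subgroup G) : Set G)) : Continuous fun g => ((ψ g : ℂˣ) : ℂ) := by
  refine IsLocallyConstant.continuous ((IsLocallyConstant.iff_exists_open _).2 fun g => ?_)
  refine ⟨(fun k => g * k) '' (ψ.ker : Set G), (isOpenMap_mul_left g) _ h, ⟨1, ψ.ker.one_mem, mul_one g⟩, ?_⟩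
  rintro _ ⟨k, hk, rfl⟩
  rw [map_mul, (MonoidHom.mem_ker).1 hk, mul_one]

/-! ## §2 Generic: in `i_P^G(χ)`, complementary subrepresentations with one-dimensional Jacquet module are inequivalent -/

section Generic

universe u

variable {G : Type u} [Group G] [TopologicalSpace G] [IsTopologicalGroup G]

/-- **Complementary subrepresentations of `i_P^G(χ)` are INEQUIVALENT once `dim r_P N = 1`** (any parabolic triple `t = (P, M, N_t)` with `δ_P|_{N_t} = 1`,
any character `χ` of `M`; `ρ` the normalised induction `i_P^G(𝟙 ⊗ χ)`, `N ⊕ N′ = ρ`, `N ≠ 0`, `ρ` smooth, `r_P(N)` one-dimensional): an isomorphism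
`e : N′ ≅ N` would give two `G`-maps `N → ρ` — the inclusion and `N ≅ N′ ↪ ρ` — which Frobenius reciprocity (★ `intertwiningMap_normalizedInd_eq_smul`:
`Hom_G(N, ρ) ≅ Hom_M(r_P N, ℂ_χ)`, a line) makes proportional; so `N′ ≤ N`, whence `N′ = N ⊓ N′ = 0` and `N = ρ`, contradicting `N ≠ ⊤`.  (Stated with an equation `hρ` so that consumers whose `ρ` is a NAMED induced representation, e.g. ★ `cmPrincipalSeries`, apply
it through ★ `cmPrincipalSeries_eq_normalizedInd` without definitional unfolding.) [cite: Casselman1995, Thm. 3.2.4, Prop. 7.1.3 p. 67]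
[cite: BernsteinZelevinsky1977, Prop. 1.9 (b)] -/
theorem isEmpty_equiv_of_isCompl_of_finrank_coinvariants_eq_one (t : ParabolicTriple G) [LocallyCompactSpace t.P]
    (χ : ↥t.M →* ℂˣ) (hδ : ∀ (n : G) (hn : n ∈ t.N), deltaChar t.P ⟨n, t.N_le hn⟩ = 1)
    {ρ : Representation ℂ G (Representation.SmoothInd t.P
      (Representation.twist (((Representation.trivial ℂ ↥t.M ℂ).twist χ).comp t.proj) (rootDeltaChar t.P)))}
    (hρ : ρ = Representation.normalizedInd t ((Representation.trivial ℂ ↥t.M ℂ).twist χ)) (hsm : ρ.IsSmooth)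
    {N N' : Subrepresentation ρ} (hc : IsCompl N N') (hb : N ≠ ⊥) (ht : N ≠ ⊤)
    (hrk : Module.finrank ℂ (t.restrict N.toRepresentation).Coinvariants = 1) :
    IsEmpty (N'.toRepresentation.Equiv N.toRepresentation) := by
  subst hρ
  refine ⟨fun e => ?_⟩
  have hc' : IsCompl N.toSubmodule N'.toSubmodule := Subrepresentation.isCompl_iff.1 hc
  have hb' : N' ≠ ⊥ := fun h => ht (eq_top_of_isCompl_bot (h ▸ hc))
  -- two `G`-maps `N → ρ`: the inclusion `B₁`, and `B₂ : N ≅ N′ ↪ ρ`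
  have h₁ : Subrepresentation.subtypeIntertwiningMap N ≠ 0 := Subrepresentation.subtypeIntertwiningMap_ne_zero hb
  obtain ⟨c, hcB⟩ := Cruxes.H413.F0P2pJacquetConstituentLemmas.intertwiningMap_normalizedInd_eq_smul t hδ N.toRepresentation
    (hsm.toRepresentation N) χ (fun ψ₁ ψ₂ hψ₁ => intertwiningMap_eq_smul_of_finrank_eq_one hrk ψ₁ ψ₂ hψ₁)
    (Subrepresentation.subtypeIntertwiningMap N) ((Subrepresentation.subtypeIntertwiningMap N').comp e.symm.toIntertwiningMap) h₁
  -- hence `N′ ≤ N`, so `N′ = ⊥`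
  apply hb'
  apply Subrepresentation.toSubmodule_injective
  change N'.toSubmodule = ⊥
  rw [eq_bot_iff]
  intro y hy
  have h2 : ((Subrepresentation.subtypeIntertwiningMap N').comp e.symm.toIntertwiningMap) (e ⟨y, hy⟩) = y := by
    rw [Representation.IntertwiningMap.comp_apply, Representation.Equiv.coe_toIntertwiningMap, Representation.Equiv.symm_apply_apply]
    rfl
  have h4 : ((Subrepresentation.subtypeIntertwiningMap N').comp e.symm.toIntertwiningMap) (e ⟨y, hy⟩) =
      (c • Subrepresentation.subtypeIntertwiningMap N) (e ⟨y, hy⟩) := by rw [hcB]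
  rw [h2, Representation.IntertwiningMap.smul_apply] at h4
  have hyN : y ∈ N.toSubmodule := by
    rw [h4]
    exact N.toSubmodule.smul_mem c (e ⟨y, hy⟩).2
  exact (Submodule.mem_bot ℂ).2 ((Submodule.disjoint_def.1 hc'.disjoint) y hyN hy)

end Generic

/-! ## §3 (TWO) from a non-trivial decomposition `i_G(χ) = N ⊕ N′` on `U(Φ₂)(L⁺_v)` -/

set_option synthInstance.maxHeartbeats 400000 in  -- instance paths on the CM carrier (as ★ `finrank_restrict_eq_one_of_ne_bot_of_ne_top_two`)
set_option maxHeartbeats 2000000 in  -- statement-heavy (`Subrepresentation (cmPrincipalSeries …)`), as the ★ K2E3 inputs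
/-- **Complementary proper non-zero subrepresentations of `i(χ) = cmPrincipalSeries L 2 v χ` are INEQUIVALENT** (`v` non-split, `χ` continuous): §2 at the
Borel triple of `U(Φ₂)(L⁺_v)` (`δ_B|_N = 1` ★, `i(χ)` smooth ★, ★ `cmPrincipalSeries_eq_normalizedInd`) with `dim r_B N = 1` (★
`finrank_restrict_eq_one_of_ne_bot_of_ne_top_two`). [cite: Casselman1995, Thm. 3.2.4, Prop. 7.1.3 p. 67] [cite: Rogawski1990, §11.1 p. 161] -/
theorem isEmpty_equiv_of_isCompl_cmPrincipalSeries_two (L : Type) [Field L] [NumberField L] [IsCMField L]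
    (v : HeightOneSpectrum (𝓞 ↥(maximalRealSubfield L))) (hns : ∀ w : PlacesOver L v, IsCMField.complexConj L • w.1 = w.1)
    (χ : ↥(torusU (conjLocal L (IsCMField.complexConj L) v) (cmLocalForm L 2 v)) →* ℂˣ) (hχ : Continuous fun t => ((χ t : ℂˣ) : ℂ))
    (N N' : Subrepresentation (cmPrincipalSeries L 2 v χ)) (hc : IsCompl N N') (hb : N ≠ ⊥) (ht : N ≠ ⊤) :
    IsEmpty (N'.toRepresentation.Equiv N.toRepresentation) := by
  haveI := locallyCompactSpace_cmBorelU L 2 v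
  have hsm : (cmPrincipalSeries L 2 v χ).IsSmooth := Cruxes.H413.K2E3LocalIrrepCuspidalOrPrincipalTwo.isSmooth_cmPrincipalSeries L 2 v χ
  have hrk := Cruxes.H413.K2E3U2PrincipalSeriesNoThreeChain.finrank_restrict_eq_one_of_ne_bot_of_ne_top_two L v hns χ hχ hb ht
  exact isEmpty_equiv_of_isCompl_of_finrank_coinvariants_eq_one (cmBorelTriple L 2 v) χ
    (deltaChar_cmBorelTriple_eq_one_of_mem_N L 2 v) (cmPrincipalSeries_eq_normalizedInd L v 2 χ) hsm hc hb ht hrk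

set_option synthInstance.maxHeartbeats 400000 in  -- as above
set_option maxHeartbeats 4000000 in  -- statement-heavy: two Jordan–Hölder descriptions (`N`, `N′`) of `Subrepresentation (cmPrincipalSeries …)` (2× ★ `reducible_cut_cmPrincipalSeries_two`'s budget)
/-- **(TWO) ⟸ (DECOMP) on `U(Φ₂)(L⁺_v)`** (`v` non-split, `χ` a CONTINUOUS character of the diagonal torus, `i(χ) = cmPrincipalSeries L 2 v χ`): if `i(χ)` has
complementary subrepresentations `N ⊕ N′ = i(χ)` with `⊥ ≠ N ≠ ⊤`, then `JH(i(χ)) = {⟦N⟧, ⟦N′⟧}` with `⟦N⟧ ≠ ⟦N′⟧` — ★ no 3-chains make `N, N′, i(χ) ⁄ N` irreducible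
and `JH = {⟦i(χ) ⁄ N⟧, ⟦N⟧}` (★ `ConstituentsOfExtension`); `⟦N′⟧ ≠ ⟦N⟧` by `isEmpty_equiv_of_isCompl_cmPrincipalSeries_two`; so `⟦N′⟧ = ⟦i(χ) ⁄ N⟧`.  The conclusion is
the `hTwo` input of ★ `lds_of_two_of_orbit` at `(L, v, χ)`. [cite: Casselman1995, Thm. 3.2.4, Cor. 7.1.2, Prop. 7.1.3 p. 67] [cite: Rogawski1990, §11.1 p. 161] -/
theorem two_of_isCompl (L : Type) [Field L] [NumberField L] [IsCMField L]
    (v : HeightOneSpectrum (𝓞 ↥(maximalRealSubfield L))) (hns : ∀ w : PlacesOver L v, IsCMField.complexConj L • w.1 = w.1)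
    (χ : ↥(torusU (conjLocal L (IsCMField.complexConj L) v) (cmLocalForm L 2 v)) →* ℂˣ) (hχ : Continuous fun t => ((χ t : ℂˣ) : ℂ))
    (N N' : Subrepresentation (cmPrincipalSeries L 2 v χ)) (hc : IsCompl N N') (hb : N ≠ ⊥) (ht : N ≠ ⊤) :
    ∃ π₁ π₂ : IrrClass ((cmDatum L 2 (Matrix.of fun i j : Fin 2 => if i.val + j.val + 1 = 2 then (1 : L) else 0)).Local v),
      π₁ ≠ π₂ ∧ ∀ c, c.IsConstituentOf (cmPrincipalSeries L 2 v χ) ↔ c = π₁ ∨ c = π₂ := by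
  have hE := isEmpty_equiv_of_isCompl_cmPrincipalSeries_two L v hns χ hχ N N' hc hb ht
  haveI := locallyCompactSpace_cmBorelU L 2 v
  have hlen := Cruxes.H413.K2E3U2PrincipalSeriesNoThreeChain.not_bot_lt_lt_lt_top_cmPrincipalSeries_two L v hns χ
  have hsm : (cmPrincipalSeries L 2 v χ).IsSmooth := Cruxes.H413.K2E3LocalIrrepCuspidalOrPrincipalTwo.isSmooth_cmPrincipalSeries L 2 v χ
  -- `N′` is proper and non-zero as well
  have hb' : N' ≠ ⊥ := by
    intro h
    subst h
    exact ht (eq_top_of_isCompl_bot hc)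
  have ht' : N' ≠ ⊤ := by
    intro h
    subst h
    exact hb (eq_bot_of_isCompl_top hc)
  -- irreducibility (no 3-chains) and the Jordan–Hölder sets through `N` and through `N′`
  have hNirr := IrrClass.isIrreducible_toRepresentation_of_forall_not_lt_lt hlen hb ht
  have hQirr := IrrClass.isIrreducible_quotientRep_of_forall_not_lt_lt hlen hb ht
  have hN'irr := IrrClass.isIrreducible_toRepresentation_of_forall_not_lt_lt hlen hb' ht'
  have hQ'irr := IrrClass.isIrreducible_quotientRep_of_forall_not_lt_lt hlen hb' ht'
  have hJH := IrrClass.isConstituentOf_iff_of_isIrreducible hsm N hNirr hQirr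
  have hJH' := IrrClass.isConstituentOf_iff_of_isIrreducible hsm N' hN'irr hQ'irr
  -- `⟦N′⟧ ≠ ⟦N⟧` (Frobenius reciprocity; `dim r_B N = 1`)
  have hne : IrrClass.mk (SmoothIrrep.mk ↥N'.toSubmodule N'.toRepresentation hN'irr (hsm.toRepresentation N')) ≠
      IrrClass.mk (SmoothIrrep.mk ↥N.toSubmodule N.toRepresentation hNirr (hsm.toRepresentation N)) := fun h =>
    ((IrrClass.mk_eq_mk_iff _ _).1 h).elim fun e => hE.false e
  -- conclude: `JH = {⟦i(χ)⁄N⟧, ⟦N⟧}` and `⟦N′⟧` is the first of the two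
  have hN'c : (IrrClass.mk (SmoothIrrep.mk ↥N'.toSubmodule N'.toRepresentation hN'irr (hsm.toRepresentation N'))).IsConstituentOf
      (cmPrincipalSeries L 2 v χ) := (hJH' _).2 (Or.inr rfl)
  have hN'Q := ((hJH _).1 hN'c).resolve_right hne
  refine ⟨IrrClass.mk (SmoothIrrep.mk ↥N.toSubmodule N.toRepresentation hNirr (hsm.toRepresentation N)),
    IrrClass.mk (SmoothIrrep.mk ↥N'.toSubmodule N'.toRepresentation hN'irr (hsm.toRepresentation N')), hne.symm, fun c => ?_⟩
  exact (hJH c).trans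
    ⟨fun h => h.elim (fun hq => Or.inr (hq.trans hN'Q.symm)) Or.inl, fun h => h.elim Or.inr fun hn' => Or.inl (hn'.trans hN'Q)⟩

/-! ## §4 Socket S4#B5 from (DECOMP) and (SWAP) -/

set_option synthInstance.maxHeartbeats 400000 in  -- as §3
set_option maxHeartbeats 1600000 in  -- statement-heavy composition (`Subrepresentation (cmPrincipalSeries …)` binder); no search
/-- **SOCKET S4#B5 `stub_R90_S4_H_lds` FROM (DECOMP) AND (SWAP)**, under the socket's own binders and guards: at a non-split `v`, for `χ₁, χ₂` with open
kernels and `χ₁|F_v^× = ω_{E/F}`, IF `i_G((χ₁, χ₂))` has complementary subrepresentations `N ⊕ N′` with `⊥ ≠ N ≠ ⊤` [§11.1 p. 161 case 2): `χ` unitary and `i_G(χ)`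
reducible ⇒ `i_G(χ) = π⁺ ⊕ π⁻`] and every local similitude of `Φ₂` with non-norm multiplier moves every constituent [ibid., «l.d.s. L-packet»; Labesse–Langlands],
THEN the socket's statement (B's `U2Loc ∕ IsRogPacketU2 ∕ IsU2SimilConj` unfolded): ★ `stub_R90_S4_H_lds_of_two_of_orbit` ∘ (`two_of_isCompl`, ★ p03
`hOrbit_of_hTwo_of_swap`). [cite: Rogawski1990, §11.1 p. 161; §12.1 p. 171] [cite: Casselman1995, Cor. 7.1.2, Prop. 7.1.3 p. 67] -/
theorem stub_R90_S4_H_lds_of_decomp_of_swap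
    (hDecomp : ∀ (L : Type) [Field L] [NumberField L] [IsCMField L] (v : HeightOneSpectrum (𝓞 ↥(maximalRealSubfield L))),
      (∀ w : PlacesOver L v, IsCMField.complexConj L • w.1 = w.1) →
      ∀ (χ₁ : (LocalRing L v)ˣ →* ℂˣ) (χ₂ : ↥(normOneUnits (conjLocal L (IsCMField.complexConj L) v)) →* ℂˣ),
        IsOpen ((χ₁.ker : Subgroup (LocalRing L v)ˣ) : Set (LocalRing L v)ˣ) →
        IsOpen ((χ₂.ker : Subgroup ↥(normOneUnits (conjLocal L (IsCMField.complexConj L) v))) :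
          Set ↥(normOneUnits (conjLocal L (IsCMField.complexConj L) v))) →
        IsQuadraticCharExtension (conjLocal L (IsCMField.complexConj L) v) χ₁ →
        ∃ N N' : Subrepresentation (cmPrincipalSeries L 2 v
            (torusCharPair (conjLocal L (IsCMField.complexConj L) v) (cmLocalForm L 2 v) (cmLocalForm_eq_over L 2 v) 0 χ₁ χ₂)),
          IsCompl N N' ∧ N ≠ ⊥ ∧ N ≠ ⊤)
    (hSwap : ∀ (L : Type) [Field L] [NumberField L] [IsCMField L] (v : HeightOneSpectrum (𝓞 ↥(maximalRealSubfield L))),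
      (∀ w : PlacesOver L v, IsCMField.complexConj L • w.1 = w.1) →
      ∀ (χ₁ : (LocalRing L v)ˣ →* ℂˣ) (χ₂ : ↥(normOneUnits (conjLocal L (IsCMField.complexConj L) v)) →* ℂˣ),
        IsOpen ((χ₁.ker : Subgroup (LocalRing L v)ˣ) : Set (LocalRing L v)ˣ) →
        IsOpen ((χ₂.ker : Subgroup ↥(normOneUnits (conjLocal L (IsCMField.complexConj L) v))) :
          Set ↥(normOneUnits (conjLocal L (IsCMField.complexConj L) v))) →
        IsQuadraticCharExtension (conjLocal L (IsCMField.complexConj L) v) χ₁ →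
        ∀ π : IrrClass ((cmDatum L 2 (Matrix.of fun i j : Fin 2 => if i.val + j.val + 1 = 2 then (1 : L) else 0)).Local v),
          π.IsConstituentOf (cmPrincipalSeries L 2 v
            (torusCharPair (conjLocal L (IsCMField.complexConj L) v) (cmLocalForm L 2 v) (cmLocalForm_eq_over L 2 v) 0 χ₁ χ₂)) →
          ∀ (T : GL (Fin 2) (LocalRing L v)) (a : LocalRing L v) (ha : IsUnit a)
            (h : formCongr (conjLocal L (IsCMField.complexConj L) v) T
              ((Matrix.of fun i j : Fin 2 => if i.val + j.val + 1 = 2 then (1 : L) else 0).map (algebraMap L (LocalRing L v))) =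
              a • (Matrix.of fun i j : Fin 2 => if i.val + j.val + 1 = 2 then (1 : L) else 0).map (algebraMap L (LocalRing L v))),
            (¬ ∃ z : LocalRing L v, IsUnit z ∧ a = conjLocal L (IsCMField.complexConj L) v z * z) →
            IrrClass.comap (cmDatumLocalCongr L v T ha h) π ≠ π) :
    ∀ (L : Type) [Field L] [NumberField L] [IsCMField L] (v : HeightOneSpectrum (𝓞 ↥(maximalRealSubfield L))),
      (∀ w : PlacesOver L v, IsCMField.complexConj L • w.1 = w.1) →
      ∀ (χ₁ : (LocalRing L v)ˣ →* ℂˣ) (χ₂ : ↥(normOneUnits (conjLocal L (IsCMField.complexConj L) v)) →* ℂˣ),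
        IsOpen ((χ₁.ker : Subgroup (LocalRing L v)ˣ) : Set (LocalRing L v)ˣ) →
        IsOpen ((χ₂.ker : Subgroup ↥(normOneUnits (conjLocal L (IsCMField.complexConj L) v))) :
          Set ↥(normOneUnits (conjLocal L (IsCMField.complexConj L) v))) →
        IsQuadraticCharExtension (conjLocal L (IsCMField.complexConj L) v) χ₁ →
        ∃ O : Finset (IrrClass ((cmDatum L 2 (Matrix.of fun i j : Fin 2 => if i.val + j.val + 1 = 2 then (1 : L) else 0)).Local v)),
          (∃ σ : IrrClass ((cmDatum L 2 (Matrix.of fun i j : Fin 2 => if i.val + j.val + 1 = 2 then (1 : L) else 0)).Local v),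
            σ.IsAdmissible ∧ ∀ c, c ∈ O ↔
              ∃ (T : GL (Fin 2) (LocalRing L v)) (a : LocalRing L v) (ha : IsUnit a)
                (h : formCongr (conjLocal L (IsCMField.complexConj L) v) T
                  ((Matrix.of fun i j : Fin 2 => if i.val + j.val + 1 = 2 then (1 : L) else 0).map (algebraMap L (LocalRing L v))) =
                  a • (Matrix.of fun i j : Fin 2 => if i.val + j.val + 1 = 2 then (1 : L) else 0).map (algebraMap L (LocalRing L v))),
                c = IrrClass.comap (cmDatumLocalCongr L v T ha h) σ) ∧
          O.card = 2 ∧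
          ∀ c : IrrClass ((cmDatum L 2 (Matrix.of fun i j : Fin 2 => if i.val + j.val + 1 = 2 then (1 : L) else 0)).Local v), c ∈ O ↔
            c.IsConstituentOf
              (cmPrincipalSeries L 2 v
                (torusCharPair (conjLocal L (IsCMField.complexConj L) v) (cmLocalForm L 2 v) (cmLocalForm_eq_over L 2 v) 0 χ₁ χ₂)) :=
  have hTwo : ∀ (L : Type) [Field L] [NumberField L] [IsCMField L] (v : HeightOneSpectrum (𝓞 ↥(maximalRealSubfield L))),
      (∀ w : PlacesOver L v, IsCMField.complexConj L • w.1 = w.1) →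
      ∀ (χ₁ : (LocalRing L v)ˣ →* ℂˣ) (χ₂ : ↥(normOneUnits (conjLocal L (IsCMField.complexConj L) v)) →* ℂˣ),
        IsOpen ((χ₁.ker : Subgroup (LocalRing L v)ˣ) : Set (LocalRing L v)ˣ) →
        IsOpen ((χ₂.ker : Subgroup ↥(normOneUnits (conjLocal L (IsCMField.complexConj L) v))) :
          Set ↥(normOneUnits (conjLocal L (IsCMField.complexConj L) v))) →
        IsQuadraticCharExtension (conjLocal L (IsCMField.complexConj L) v) χ₁ →
        ∃ π₁ π₂ : IrrClass ((cmDatum L 2 (Matrix.of fun i j : Fin 2 => if i.val + j.val + 1 = 2 then (1 : L) else 0)).Local v),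
          π₁ ≠ π₂ ∧ ∀ c, c.IsConstituentOf (cmPrincipalSeries L 2 v
            (torusCharPair (conjLocal L (IsCMField.complexConj L) v) (cmLocalForm L 2 v) (cmLocalForm_eq_over L 2 v) 0 χ₁ χ₂)) ↔
              c = π₁ ∨ c = π₂ :=
    fun L _ _ _ v hv χ₁ χ₂ hχ₁ hχ₂ hq => by
      obtain ⟨N, N', hc, hb, ht⟩ := hDecomp L v hv χ₁ χ₂ hχ₁ hχ₂ hq
      exact two_of_isCompl L v hv _
        (continuous_torusCharPair_apply (conjLocal L (IsCMField.complexConj L) v) (cmLocalForm L 2 v) (cmLocalForm_eq_over L 2 v) 0 χ₁ χ₂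
          (continuous_unitsCoe_of_isOpen_ker χ₁ hχ₁) (continuous_unitsCoe_of_isOpen_ker χ₂ hχ₂))
        N N' hc hb ht
  stub_R90_S4_H_lds_of_two_of_orbit hTwo (hOrbit_of_hTwo_of_swap hTwo hSwap)

end Summit.HodgeConjecture.HodgeConjecture.R90.S4

end
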